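import Summits.QuantumAdvantage.AdviceFreeQNC0.AffBells27Windows
import Summits.QuantumAdvantage.AdviceFreeQNC0.AffBells27FrameGlue
import Summits.QuantumAdvantage.AdviceFreeQNC0.AffBells26CubeIdentityGen
import Summits.QuantumAdvantage.AdviceFreeQNC0.AffBells26TargetFormula
import HarnessLib

/-!
# Sketch27 §27.4 (planner qn-p1 g27, ROUND-26 §8): THE REVISED FRAME / FAR-FROM-FRAME DICHOTOMY for (NP₁) — `HWFar₀` (the one open
# statement), the assembly `polyLossOfDichotomy₀` (PROVED by the planner), the lone-deviator lemma; + the prover's discharge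

(VERBATIM copy of lines 646–770 of `HOME/qa-qnc0-p1/exp27/Sketch27.lean` (sha16 `7554022ab31b35b7`), authored by the planner seat qn-p1 g27;
landed by the prover seat qn-prover-3 g14 (ask P-27e).  Changes: this paragraph; `FrameDecomp` / `AffFrameLoss` are NOT re-declared (they are
the landed `AffBells27.FrameDecomp` / `AffBells27.AffFrameLoss`, same text, reached by `open AffBells27`); §27.3 (`HWFar`,
`PolyLossOfDichotomy`, superseded by §27.4 per the planner) is not ported; and the corollary `affBellsPolyLoss3_of` at the end is new.)

**Net statement for the cell** (`affBellsPolyLoss3_of`): with `cubeIdentityGen` (AffBells26CubeIdentityGen), `targetFormula`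
(AffBells26TargetFormula) and `AffBells27.affFrameLoss` (AffBells27FrameGlue) all PROVED, the (NP₁) rung `AffBellsPolyLoss3` follows from
exactly TWO open statements: the windowed density upgrade `DensityUpgradeWin` (prover target P-27c, a double count) and `HWFar₀` (the
mathematical crux of the window side).  WHAT THIS IS NOT: neither of those two is proved here; separation NOT moved.
-/

namespace Summit.QuantumAdvantage.AdviceFreeQNC0

namespace AffBells26

open Finset Literature.Computability.QuantumComplexity Literature.Computability.QuantumComplexity.RingHLF
open AffBells23 Fib19 AffBells27

/-! ## §27.4 — THE REVISED DICHOTOMY (16:10Z): frame side PROVED, window side = the one open statement `HWFar₀`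

`exp27/AffBells27FrameGlue.lean` (rc 0, 0 sorry; imports only landed `AffBells22FrameAveraging` / `AffBells22FrameLinCommon` / `AffBells23NearPerfect`)
PROVES `AffFrameLoss` below from the landed `AffBells22.ringFrameJuntaLinCommonLt3` (frame averaging with a LINEAR common junta) + an elementary
regularization induction.  So the frame side needs NO regularity and NO logarithmic extension (S-27F, S-27F′ of ROUND-26 §6 are DISCHARGED /
OBSOLETE), and it swallows every sparse or irregular frame direction of weight `< N/2` (put its support into `J₀`) — exactly the families the windows
cannot see (`irrframe5`: best-`c` pass `.91 → .99`, c-dependent survivors `R ≈ 2 → 0.2`, kit j311820).  What remains is the window side for strategies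
that are FAR from every (linear common junta ⊕ dimension-`< r₀` frame ⊕ own `w₀`-junta): `HWFar₀`. -/

/- `FrameDecomp δ₀ r₀ w₀ β` and `AffFrameLoss` (Sketch27 §27.4, verbatim `AffBells27.FrameDecomp` / `AffBells27.AffFrameLoss` of the landed glue
file `AffBells27FrameGlue.lean`, where `AffBells27.affFrameLoss : AffFrameLoss` is PROVED) are not re-declared here; the names below resolve to
the landed ones through `open AffBells27`. -/

/-- **(W) `HWFar₀` — THE OPEN STATEMENT of the (NP₁) plan** (replaces `HWFar` of §27.3): for SOME junta budget `δ₀ < 1/2`, frame dimension `r₀`,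
own-junta width `w₀`, rate exponent `a` and window excess `K`, every affine strategy that is NOT `FrameDecomp δ₀ r₀ w₀`-decomposable is refuted,
under ITS OWN offsets `c`, by at least a `1/N^a` fraction of the windows with `log₂N + K` coins (`WindowRefutable`, §27.2).  All parameters are the
prover's to choose (the frame side holds for all of them).  Why it might fail: a far-from-frame strategy on which surviving rows always come in
cancelling families (cube contributions vanish mod 2, cf. `CubeTargetEven`); the recorded candidates (twins, replicated rows, sparse/irregular frames,
frame + defect) are either decomposable (hence on the F side) or split by positional activity (twin4: pass `.23 → .11`). -/
def HWFar₀ : Prop :=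
  ∃ δ₀ : ℝ, δ₀ < 1 / 2 ∧ ∃ r₀ w₀ a K N₀ : ℕ, ∀ N ≥ N₀, ∀ (β : Fin N → Fin N → ZMod 3) (c : Fin N → ZMod 3),
    ¬ FrameDecomp δ₀ r₀ w₀ β → WindowRefutable ((1 : ℝ) / (N : ℝ) ^ a) (Nat.log 2 N + K) β c

/-- **Assembly of (NP₁) from the revised dichotomy** (bookkeeping, ask P-27e): the two proved/provable window facts, the open `HWFar₀`, and the
PROVED frame side give polynomial loss for every affine strategy. -/
def PolyLossOfDichotomy₀ : Prop :=
  DensityUpgradeWin → CubeIdentityGen → TargetFormula → HWFar₀ → AffFrameLoss → AffBellsPolyLoss3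


/-- **Assembly PROVED** (P-27e discharged): the dichotomy gives (NP₁) with exponent `e = a + K + 4`. -/
theorem polyLossOfDichotomy₀ : PolyLossOfDichotomy₀ := by
  intro hU h0 h1 hW hF
  obtain ⟨δ₀, hδ₀, r₀, w₀, a, K, N₀, hfar⟩ := hW
  obtain ⟨θ, hθ, n₀, hn₀⟩ := hF δ₀ hδ₀ r₀ w₀
  obtain ⟨M, hM⟩ := exists_nat_gt (1 / (1 - θ))
  refine ⟨a + K + 4, max (max N₀ n₀) (max M 5), fun N hN β c => ?_⟩
  have hN₀ : N₀ ≤ N := le_trans (le_max_left _ _) (le_trans (le_max_left _ _) hN)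
  have hn₀' : n₀ ≤ N := le_trans (le_max_right _ _) (le_trans (le_max_left _ _) hN)
  have hM' : M ≤ N := le_trans (le_max_left _ _) (le_trans (le_max_right _ _) hN)
  have h5 : 5 ≤ N := le_trans (le_max_right _ _) (le_trans (le_max_right _ _) hN)
  have hNpos : (0 : ℝ) < N := by exact_mod_cast (show 0 < N by omega)
  have hN1 : (1 : ℝ) ≤ N := by exact_mod_cast (show 1 ≤ N by omega)
  have hN2 : (2 : ℝ) ≤ N := by exact_mod_cast (show 2 ≤ N by omega)
  have h2pow : (0 : ℝ) < (2 : ℝ) ^ (N - 1) := by positivity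
  have hθ1 : 0 < 1 - θ := by linarith
  by_cases hdec : FrameDecomp δ₀ r₀ w₀ β
  · -- frame side: θ ≤ 1 - 1/N^e for N ≥ M > 1/(1-θ)
    have hwin := hn₀ N hn₀' β c hdec
    have hMpos : (0 : ℝ) < M := by
      have : (0 : ℝ) < 1 / (1 - θ) := by positivity
      linarith
    have hinv : 1 / (N : ℝ) ≤ 1 - θ := by
      have h1 : 1 / (N : ℝ) ≤ 1 / (M : ℝ) := one_div_le_one_div_of_le hMpos (by exact_mod_cast hM')
      have h2 : 1 / (M : ℝ) < 1 - θ := by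
        rw [div_lt_iff₀ hMpos]
        have := (div_lt_iff₀ hθ1).mp hM
        linarith
      linarith
    have hpow : 1 / (N : ℝ) ^ (a + K + 4) ≤ 1 / (N : ℝ) := by
      apply one_div_le_one_div_of_le hNpos
      calc (N : ℝ) = (N : ℝ) ^ 1 := (pow_one _).symm
        _ ≤ (N : ℝ) ^ (a + K + 4) := pow_le_pow_right₀ hN1 (by omega)
    have : θ * (2 : ℝ) ^ (N - 1) ≤ (1 - 1 / (N : ℝ) ^ (a + K + 4)) * (2 : ℝ) ^ (N - 1) := by
      apply mul_le_mul_of_nonneg_right _ h2pow.le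
      linarith
    exact hwin.trans this
  · -- window side
    have hδ : (0 : ℝ) < 1 / (N : ℝ) ^ a := by positivity
    have hWR := hfar N hN₀ β c hdec
    have hwin := affWin_le_of_windowRefutable hU h0 h1 h5 K hδ β c hWR
    refine hwin.trans (mul_le_mul_of_nonneg_right ?_ h2pow.le)
    -- 1 - (1/N^a)/2^(K+3)/N ≤ 1 - 1/N^(a+K+4)
    have hK : (2 : ℝ) ^ (K + 3) ≤ (N : ℝ) ^ (K + 3) := pow_le_pow_left₀ (by norm_num) hN2 _
    have hpos1 : (0 : ℝ) < (N : ℝ) ^ a * (2 : ℝ) ^ (K + 3) * N := by positivity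
    have hle : (N : ℝ) ^ a * (2 : ℝ) ^ (K + 3) * N ≤ (N : ℝ) ^ (a + K + 4) := by
      have : (N : ℝ) ^ (a + K + 4) = (N : ℝ) ^ a * (N : ℝ) ^ (K + 3) * N := by ring
      rw [this]
      apply mul_le_mul_of_nonneg_right _ hNpos.le
      exact mul_le_mul_of_nonneg_left hK (by positivity)
    have hfrac : 1 / (N : ℝ) ^ a / (2 : ℝ) ^ (K + 3) / N = 1 / ((N : ℝ) ^ a * (2 : ℝ) ^ (K + 3) * N) := by
      field_simp
    rw [hfrac]
    have := one_div_le_one_div_of_le hpos1 hle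
    linarith


/-- **(LD) Lone-deviator lemma, abstract form** (ROUND-26 §8.4): on a finite set `S` of class points, if the frame data `Φ` and the deviating form
`ψ` satisfy (SEP) — for every value `v` some `Φ`-fibre contains a point with `ψ = v` and one with `ψ ≠ v` — then NO frame-measurable correction
`F ∘ Φ` makes `F(Φ y) + [ψ y = e]` constant on `S`, whatever the offset `e`.  (The window system after `nSub_mod_two` has exactly this shape when the
survivors are frame-measurable rows plus one deviator; so such a window refutes `(β, c)` for EVERY `c`.) -/
theorem loneDeviator {Y α : Type*} (S : Finset Y) (Φ : Y → α) (ψ : Y → ZMod 3)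
    (hsep : ∀ v : ZMod 3, ∃ y ∈ S, ∃ y' ∈ S, Φ y = Φ y' ∧ ψ y = v ∧ ψ y' ≠ v)
    (F : α → ZMod 2) (e : ZMod 3) (τ : ZMod 2) :
    ¬ ∀ y ∈ S, F (Φ y) + (if ψ y = e then 1 else 0) = τ := by
  intro h
  obtain ⟨y, hy, y', hy', hΦ, hψ, hψ'⟩ := hsep e
  have h1 := h y hy
  have h2 := h y' hy'
  rw [if_pos hψ, hΦ] at h1
  rw [if_neg hψ'] at h2
  -- h1 : F (Φ y') + 1 = τ,  h2 : F (Φ y') + 0 = τ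
  have h3 : (1 : ZMod 2) = 0 := by
    have := h1.trans h2.symm
    simp at this
  exact absurd h3 (by decide)

/-- (SEP) FAILS for a single-coin deviation: if `ψ = ψ₀ ∘ Φ + r·y_i` on a fibre then `ψ` takes only the two values `{w, w + r}` there, and the offset
`e :=` the third value makes the deviator invisible — recorded as the reason `framedefect` is never c-free refuted (0/160 at every N). Sanity instance: -/
example : ¬ ∀ v : ZMod 3, ∃ b : Bool, ∃ b' : Bool, (if b then (1 : ZMod 3) else 0) = v ∧ (if b' then (1 : ZMod 3) else 0) ≠ v := by
  intro h
  obtain ⟨b, b', hb, -⟩ := h 2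
  cases b <;> simp at hb <;> exact absurd hb (by decide)

/-- **(NP₁) from the two open window statements** (prover's discharge of `polyLossOfDichotomy₀`: Q1-gen `cubeIdentityGen`, Q0 `targetFormula`
and the frame side `AffBells27.affFrameLoss` are tree theorems). -/
theorem affBellsPolyLoss3_of (hU : DensityUpgradeWin) (hW : HWFar₀) : AffBellsPolyLoss3 :=
  polyLossOfDichotomy₀ hU cubeIdentityGen targetFormula hW affFrameLoss

end AffBells26

end Summit.QuantumAdvantage.AdviceFreeQNC0
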